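import Literature.NumberTheory.LFunctions.CertifiedArtinHolomorphyCriterionProofs
import Literature.RepresentationTheory.FiniteGroups.InducedCharacter
import Literature.RepresentationTheory.FiniteGroups.DegreeZeroInduction
import Literature.RepresentationTheory.FiniteGroups.DeterminantCharacterExtension
import Literature.RepresentationTheory.FiniteGroups.SL23CharacterDegrees
import Literature.RepresentationTheory.FiniteGroups.NonabelianCharDegree
import Literature.RepresentationTheory.FiniteGroups.AbelianSubgroupIndexDegree
import HarnessLib

/-!
# Irreducible characters of degree `≤ 3` never split into DM-positive virtual characters;
# `SL₂(𝔽₃)` is almost monomial (Booker 2006, Prop. 2.3, first group) — proved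

Topic `Literature/NumberTheory/LFunctions`; companion (theorems only; no definition, no named
fact; standard axioms) of `CertifiedArtinHolomorphyCriterion.lean` /
`CertifiedArtinHolomorphyCriterionProofs.lean`, where Booker's notions are typed:
`Booker2006.IsDMPositive χ` ("`⟨χ, σ⟩ ≥ 0` for all monomial `σ = Ind_H^G λ`"),
`Booker2006.IsAlmostMonomial G` (Exp. Math. 15 (2006) **Definition 2.1**, p. 389: "if
`Tr ρ = χ₁ + χ₂` for virtual characters `χᵢ` such that `⟨χᵢ, σ⟩ ≥ 0` for all monomial `σ`, then
either `χ₁ = 0` or `χ₂ = 0`") and the NAMED FACT `booker2006_proposition23` (**Proposition 2.3**,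
first clause, p. 390: "The groups `SL₂(𝔽₃)`, `A₅`, and `S₅` are almost monomial", "shown with the
aid of the computer algebra system GAP").

## What is proved (the engine, for every finite group `G`)

The source proves Prop. 2.3 by a GAP computation ("enumerate the monomial characters, solve the
integral system (2–7)").  This file replaces the `SL₂(𝔽₃)` third of that computation by a
structural theorem and supplies the lemmas ("the engine") that reduce the `A₅` / `S₅` thirds to a
handful of scalar products (sequel files):

* `Booker2006.IsDMPositive.exists_nat_classInner_indClassFun` — for a DM-positive VIRTUAL
  character `χ` and any `H ≤ G`, `θ : H → ℂˣ`: `⟨χ, Ind_H^G θ⟩ ∈ ℕ` (integrality on `R(G)`,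
  positivity = Definition 2.1);
* `Booker2006.IsDMPositive.exists_nat_apply_one_and_norm_le` — **Frobenius reciprocity on the
  cyclic subgroups**: for DM-positive `χ ∈ R(G)` and `g ∈ G`, the restriction of `χ` to `⟨g⟩` has
  non-negative integral Fourier coefficients `⟨χ, Ind_{⟨g⟩}^G λ⟩` against the linear characters `λ`
  of `⟨g⟩`, i.e. it is a genuine character of `⟨g⟩`; hence `χ(1) = N ∈ ℕ` and `|χ(g)| ≤ N`;
  consequences `IsDMPositive.eq_zero_of_apply_one_eq_zero` (`χ(1) = 0 ⇒ χ = 0`) and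
  `IsDMPositive.isIrrChar_of_apply_one_eq_one` (`χ(1) = 1 ⇒ χ` is a LINEAR CHARACTER: `⟨χ, χ⟩ =
  |G|⁻¹ Σ |χ(g)|² ≤ 1` while `⟨χ, χ⟩ = Σ_ψ ⟨χ, ψ⟩² ∈ ℤ_{>0}`, so `χ = ±ψ₀`, and `χ(1) = 1` fixes the sign
  and the degree);
* `Booker2006.eq_zero_of_split_of_apply_one_eq` — in a splitting `Tr ρ = χ₁ + χ₂` (both DM-positive
  virtual), `χ₁(1) = Tr ρ(1)` forces `χ₂ = 0` (the **degree criterion** used by the sequel files);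
  `Booker2006.classInner_add_eq_of_split`, `Booker2006.classInner_coe_monoidHom_eq_zero_of_split`
  (no linear constituents `λ ≠ Tr ρ` in `χ₁`);
* **`Booker2006.eq_zero_or_eq_zero_of_split_of_apply_one_le_three`** — if `Tr ρ(1) ≤ 3` then
  `χ₁ = 0 ∨ χ₂ = 0`: by the above one `χᵢ` has degree `0` (done) or degree `1`, hence is a linear
  character `λ` with `⟨Tr ρ, λ⟩ = ⟨χ₁, λ⟩ + ⟨χ₂, λ⟩ ≥ 1`, so `λ = Tr ρ` and the other summand is `0`;
* **`Booker2006.isAlmostMonomial_of_charDegrees_le_three`** — a finite group all of whose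
  character degrees are `≤ 3` is almost monomial;
* **`Booker2006.isAlmostMonomial_SL23 : IsAlmostMonomial SL(2, ZMod 3)`** — the first group of
  Prop. 2.3 (`SL₂(𝔽₃)` is NOT an M-group; its degrees are `1,1,1,2,2,2,3`, tree:
  `JamesLiebeck2001_exercise272_degrees`, `SL23.charDegrees_subset`).

The `A₅` and `S₅` clauses of `booker2006_proposition23` (degrees `4, 5` resp. `4, 4, 5, 5, 6` occur)
need scalar products with explicit monomial characters and are left to the sequel files; the
conjunction `booker2006_proposition23` is therefore NOT discharged here.

Tree API used: `classInner_indClassFun_right` (Frobenius reciprocity), `IsClassFun.eq_sum_classInner_smul`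
(Fourier expansion), `IsIrrChar.classInner_eq` (orthonormality), `exists_int_classInner_of_mem_virtChars`,
`IsCharacter.indClassFun`, `isCharacter_coe_monoidHom'`, `IsIrrChar.apply_one_eq_one_of_isMulCommutative`,
`IsIrrChar.exists_monoidHom_of_apply_one`, `norm_character_le`, `IsCharacter.apply_inv_eq_conj`,
`indClassFun_top_apply`, `pos_of_mem_charDegrees`.

## References

* [Booker2006] A. R. Booker, *Artin's conjecture, Turing's method, and the Riemann hypothesis*,
  Experiment. Math. 15 (2006) 385–407: §2 Definition 2.1 (p. 389), Proposition 2.3 (p. 390)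
  (journal pdf `paper:url-702ab4eacdaa` pp. 5–6; arXiv:math/0507502 Definition 1, Proposition 3).
* [SerreLinearRepresentations1977] J.-P. Serre, *Linear Representations of Finite Groups*, GTM 42,
  §7.2 Thm. 13 (Frobenius reciprocity), §9.1 (`R(G)`), §2.3 Thm. 3.
* [Isaacs1976] I. M. Isaacs, *Character Theory of Finite Groups*, Lemma 2.15, Cor. 2.23.
-/

noncomputable section

open scoped ComplexOrder ComplexConjugate MatrixGroups
open Finset

namespace Literature.NumberTheory.LFunctions

namespace Booker2006

open Literature.RepresentationTheory.FiniteGroups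

variable {G : Type} [Group G] [Fintype G]

/-! ### Scalar products of virtual characters -/

/-- `Σ_{χ ∈ m} ⟨χ, f⟩ ∈ ℤ` for a virtual character `f` and a multiset `m` of irreducible characters.
[cite: SerreLinearRepresentations1977, §9.1] -/
theorem exists_int_multiset_sum_classInner_of_mem_virtChars {f : G → ℂ} (hf : f ∈ virtChars G)
    (m : Multiset (G → ℂ)) (hm : ∀ χ ∈ m, IsIrrChar G χ) :
    ∃ n : ℤ, (m.map fun χ => classInner χ f).sum = n := by
  classical
  induction m using Multiset.induction_on with
  | empty => exact ⟨0, by simp⟩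
  | cons χ m ih =>
    obtain ⟨n, hn⟩ := ih (fun χ' h' => hm χ' (Multiset.mem_cons_of_mem h'))
    obtain ⟨k, hk⟩ := exists_int_classInner_of_mem_virtChars hf (hm χ (Multiset.mem_cons_self _ _))
    refine ⟨k + n, ?_⟩
    rw [Multiset.map_cons, Multiset.sum_cons, hn, classInner_comm, hk, Int.cast_add]

/-- `⟨f, φ⟩ ∈ ℤ` for a virtual character `f` and a character `φ` (decompose `φ` into irreducible
characters; Serre §9.1). [cite: SerreLinearRepresentations1977, §9.1] -/
theorem exists_int_classInner_of_mem_virtChars_of_isCharacter {f : G → ℂ} (hf : f ∈ virtChars G)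
    {φ : G → ℂ} (hφ : IsCharacter G φ) : ∃ n : ℤ, classInner f φ = n := by
  classical
  obtain ⟨m, hm, rfl⟩ := hφ.exists_multiset_irrChars
  rw [classInner_comm, classInner_multiset_sum_left]
  exact exists_int_multiset_sum_classInner_of_mem_virtChars hf m hm

/-- A virtual character satisfies `f(g⁻¹) = conj f(g)` (true for characters, Isaacs Lemma 2.15 (d),
and preserved under differences). [cite: Isaacs1976, Lemma 2.15] -/
theorem apply_inv_eq_conj_of_mem_virtChars {f : G → ℂ} (hf : f ∈ virtChars G) (g : G) :
    f g⁻¹ = conj (f g) := by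
  refine AddSubgroup.closure_induction (p := fun f _ => ∀ g : G, f g⁻¹ = conj (f g))
    ?_ ?_ ?_ ?_ hf g
  · intro χ hχ g
    exact hχ.isCharacter.apply_inv_eq_conj g
  · intro g
    simp
  · intro a b _ _ ha hb g
    simp [ha g, hb g]
  · intro a _ ha g
    simp [ha g]

/-- Parseval for class functions: `⟨f, f⟩ = Σ_{χ ∈ Irr(G)} ⟨f, χ⟩²` (Fourier expansion +
orthonormality). [cite: SerreLinearRepresentations1977, §2.3 Thm. 3] -/
theorem classInner_self_eq_sum_sq {f : G → ℂ} (hf : IsClassFun f) :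
    classInner f f =
      ∑ χ ∈ (irrChars_finite_holds G).toFinset, classInner f χ * classInner f χ := by
  classical
  have h := hf.eq_sum_classInner_smul
  have h1 : classInner f f =
      classInner (∑ χ ∈ (irrChars_finite_holds G).toFinset, classInner f χ • χ) f :=
    congrArg (fun x => classInner x f) h
  rw [h1, classInner_sum_left]
  refine Finset.sum_congr rfl fun χ _ => ?_
  rw [classInner_smul_left, classInner_comm χ f]

/-- `|χ(s)| ≤ d` for a character of degree `d` (Isaacs Lemma 2.15 (c), tree `norm_character_le`).
[cite: Isaacs1976, Lemma 2.15] -/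
theorem norm_apply_le_of_isCharacter {χ : G → ℂ} (hχ : IsCharacter G χ) {d : ℕ} (hd : χ 1 = d)
    (s : G) : ‖χ s‖ ≤ d := by
  obtain ⟨V, _, _, _, ρ, rfl⟩ := hχ
  have h := norm_character_le ρ s
  have h1 : (Module.finrank ℂ V : ℂ) = d := by rw [← ρ.char_one]; exact hd
  have h2 : Module.finrank ℂ V = d := by exact_mod_cast h1
  rw [h2] at h
  exact h

/-- A character of degree `1` is irreducible (one-dimensional representations are irreducible).
[folklore] -/
private theorem isIrrChar_of_isCharacter_of_apply_one_eq_one {K : Type} [Group K] {lam : K → ℂ}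
    (hlam : IsCharacter K lam) (h1 : lam 1 = 1) : IsIrrChar K lam := by
  obtain ⟨V, _, _, _, ρ, rfl⟩ := hlam
  have hd : Module.finrank ℂ V = 1 := by
    have h := ρ.char_one
    rw [h1] at h
    exact_mod_cast h.symm
  exact ⟨V, _, _, inferInstance, ρ, isIrreducible_of_finrank_eq_one ρ hd, rfl⟩

omit [Fintype G] in
/-- A linear character `θ : G → ℂˣ` is an irreducible character. [folklore] -/
private theorem isIrrChar_coe_monoidHom_aux (θ : G →* ℂˣ) : IsIrrChar G (fun g => (θ g : ℂ)) :=
  isIrrChar_of_isCharacter_of_apply_one_eq_one (isCharacter_coe_monoidHom' θ) (by simp)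

/-- `Ind_G^G θ = θ` for a linear character `θ` of `G`. [folklore] -/
private theorem indClassFun_top_coe_monoidHom (θ : G →* ℂˣ) :
    indClassFun (⊤ : Subgroup G) (fun h : (⊤ : Subgroup G) => ((θ.comp (Subgroup.subtype ⊤) h : ℂˣ) : ℂ)) =
      fun g => (θ g : ℂ) := by
  have hcl : IsClassFun (fun g => (θ g : ℂ)) := (isCharacter_coe_monoidHom' θ).isClassFun
  funext s
  exact indClassFun_top_apply hcl s

/-! ### DM-positive virtual characters -/

/-- **`⟨χ, Ind_H^G θ⟩ ∈ ℕ`** for a DM-positive virtual character `χ`, any subgroup `H` and any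
`θ : H → ℂˣ`: it is an integer (`χ ∈ R(G)`, `Ind θ` a character) and `≥ 0` by Definition 2.1.
[cite: Booker2006, §2 Definition 2.1 p. 389] -/
theorem IsDMPositive.exists_nat_classInner_indClassFun {χ : G → ℂ} (hχ : χ ∈ virtChars G)
    (hpos : IsDMPositive χ) (H : Subgroup G) (θ : H →* ℂˣ) :
    ∃ n : ℕ, classInner χ (indClassFun H fun h => (θ h : ℂ)) = n := by
  have hchar : IsCharacter G (indClassFun H fun h => (θ h : ℂ)) :=
    (isCharacter_coe_monoidHom' θ).indClassFun H
  obtain ⟨m, hm⟩ := exists_int_classInner_of_mem_virtChars_of_isCharacter hχ hchar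
  have h0 : (0 : ℂ) ≤ classInner χ (indClassFun H fun h => (θ h : ℂ)) := hpos H θ
  rw [hm] at h0
  have hm0 : (0 : ℤ) ≤ m := by
    have h0' : ((0 : ℝ) : ℂ) ≤ ((m : ℝ) : ℂ) := by
      simpa [Complex.ofReal_intCast] using h0
    exact_mod_cast (Complex.real_le_real.1 h0')
  obtain ⟨n, rfl⟩ := Int.eq_ofNat_of_zero_le hm0
  exact ⟨n, by simpa using hm⟩

/-- **A DM-positive virtual character restricts to a genuine character on every cyclic subgroup**,
numerically: `χ(1) = N ∈ ℕ` and `|χ(g)| ≤ N`.  Frobenius reciprocity on `C = ⟨g⟩`: the Fourier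
coefficient of `χ|_C` against a linear character `λ` of `C` is `⟨χ, Ind_C^G λ⟩_G ∈ ℕ`; `C` being
abelian all its irreducible characters are linear, so `χ|_C = Σ n_λ λ` with `n_λ ∈ ℕ`, whence
`χ(1) = Σ n_λ` and `|χ(g)| ≤ Σ n_λ |λ(g)| ≤ Σ n_λ`. [cite: Booker2006, §2 Definition 2.1 p. 389]
[cite: SerreLinearRepresentations1977, §7.2 Thm. 13] -/
theorem IsDMPositive.exists_nat_apply_one_and_norm_le {χ : G → ℂ} (hχ : χ ∈ virtChars G)
    (hpos : IsDMPositive χ) (g : G) : ∃ N : ℕ, χ 1 = N ∧ ‖χ g‖ ≤ N := by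
  classical
  set C : Subgroup G := Subgroup.zpowers g with hC
  have hgC : g ∈ C := Subgroup.mem_zpowers g
  have hcl : IsClassFun χ := isClassFun_of_mem_virtChars hχ
  -- the restriction is a class function of the abelian group `C`
  have hrcl : IsClassFun (fun x : C => χ x) := by
    intro s t
    show χ ((t * s * t⁻¹ : C) : G) = χ (s : G)
    have hts : t * s = s * t := IsMulCommutative.is_comm.comm t s
    rw [hts, mul_inv_cancel_right]
  set F := (irrChars_finite_holds C).toFinset with hF
  have hexp := hrcl.eq_sum_classInner_smul
  -- each Fourier coefficient is a natural number; each `φ ∈ Irr(C)` is linear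
  have hcoef : ∀ φ ∈ F, ∃ n : ℕ, classInner (fun x : C => χ x) φ = n ∧ φ 1 = 1 ∧
      ∀ x : C, ‖φ x‖ ≤ 1 := by
    intro φ hφ
    have hφirr : IsIrrChar C φ := (irrChars_finite_holds C).mem_toFinset.mp hφ
    have h1 : φ 1 = 1 := hφirr.apply_one_eq_one_of_isMulCommutative
    obtain ⟨θ, hθ⟩ := hφirr.exists_monoidHom_of_apply_one h1
    obtain ⟨n, hn⟩ := hpos.exists_nat_classInner_indClassFun hχ C θ
    refine ⟨n, ?_, h1, fun x => ?_⟩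
    · rw [← hθ, ← classInner_indClassFun_right C _ hcl]
      exact hn
    · have := norm_apply_le_of_isCharacter hφirr.isCharacter (d := 1) (by rw [h1, Nat.cast_one]) x
      simpa using this
  choose! n hn h1 hle using hcoef
  refine ⟨∑ φ ∈ F, n φ, ?_, ?_⟩
  · -- evaluate the expansion at `1`
    have h := congrFun hexp 1
    change χ 1 = _ at h
    rw [h, Finset.sum_apply, Nat.cast_sum]
    refine Finset.sum_congr rfl fun φ hφ => ?_
    rw [Pi.smul_apply, smul_eq_mul, hn φ hφ, h1 φ hφ, mul_one]
  · -- evaluate the expansion at `g`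
    have h := congrFun hexp ⟨g, hgC⟩
    change χ g = _ at h
    rw [h, Finset.sum_apply, Nat.cast_sum]
    refine (norm_sum_le _ _).trans (Finset.sum_le_sum fun φ hφ => ?_)
    rw [Pi.smul_apply, smul_eq_mul, hn φ hφ, norm_mul, Complex.norm_natCast]
    calc (n φ : ℝ) * ‖φ ⟨g, hgC⟩‖ ≤ n φ * 1 :=
          mul_le_mul_of_nonneg_left (hle φ hφ _) (Nat.cast_nonneg _)
      _ = n φ := mul_one _

/-- A DM-positive virtual character has a natural-number degree. [cite: Booker2006, §2 Definition 2.1 p. 389] -/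
theorem IsDMPositive.exists_nat_apply_one_eq {χ : G → ℂ} (hχ : χ ∈ virtChars G)
    (hpos : IsDMPositive χ) : ∃ N : ℕ, χ 1 = N := by
  obtain ⟨N, hN, -⟩ := hpos.exists_nat_apply_one_and_norm_le hχ 1
  exact ⟨N, hN⟩

/-- `|χ(g)| ≤ χ(1)` (as a real number) for a DM-positive virtual character `χ`.
[cite: Booker2006, §2 Definition 2.1 p. 389] -/
theorem IsDMPositive.norm_apply_le {χ : G → ℂ} (hχ : χ ∈ virtChars G) (hpos : IsDMPositive χ)
    {N : ℕ} (hN : χ 1 = N) (g : G) : ‖χ g‖ ≤ N := by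
  obtain ⟨N', hN', hle⟩ := hpos.exists_nat_apply_one_and_norm_le hχ g
  have : N' = N := by
    have h : (N' : ℂ) = N := hN'.symm.trans hN
    exact_mod_cast h
  rw [← this]
  exact hle

/-- **A DM-positive virtual character of degree `0` is zero** (`|χ(g)| ≤ χ(1) = 0`).
[cite: Booker2006, §2 Definition 2.1 p. 389] -/
theorem IsDMPositive.eq_zero_of_apply_one_eq_zero {χ : G → ℂ} (hχ : χ ∈ virtChars G)
    (hpos : IsDMPositive χ) (h0 : χ 1 = 0) : χ = 0 := by
  funext g
  have h := hpos.norm_apply_le hχ (N := 0) (by rw [h0, Nat.cast_zero]) g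
  rw [Nat.cast_zero] at h
  exact norm_le_zero_iff.mp h

/-- For integers: `Σ_{i ∈ s} aᵢ² = 1` forces one `aᵢ = ±1` and all other `aⱼ = 0`. [folklore] -/
private theorem exists_sq_eq_one_of_sum_sq_eq_one {ι : Type*} (s : Finset ι) (a : ι → ℤ)
    (h : ∑ i ∈ s, a i * a i = 1) : ∃ i ∈ s, a i * a i = 1 ∧ ∀ j ∈ s, j ≠ i → a j = 0 := by
  classical
  -- some `aᵢ ≠ 0`
  obtain ⟨i, hi, hai⟩ : ∃ i ∈ s, a i ≠ 0 := by
    by_contra hcon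
    push Not at hcon
    have : ∑ i ∈ s, a i * a i = 0 := Finset.sum_eq_zero fun i hi => by rw [hcon i hi, mul_zero]
    omega
  have hsq : 1 ≤ a i * a i := by
    rcases lt_or_gt_of_ne hai with h' | h'
    · nlinarith
    · nlinarith
  have hrest : ∑ j ∈ s.erase i, a j * a j = 1 - a i * a i := by
    rw [← h, ← Finset.add_sum_erase s _ hi]
    ring
  have hnonneg : ∀ j ∈ s.erase i, 0 ≤ a j * a j := fun j _ => mul_self_nonneg _
  have hsum_nonneg : 0 ≤ ∑ j ∈ s.erase i, a j * a j := Finset.sum_nonneg hnonneg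
  have hai1 : a i * a i = 1 := by omega
  refine ⟨i, hi, hai1, fun j hj hji => ?_⟩
  have hzero : ∑ j ∈ s.erase i, a j * a j = 0 := by omega
  have := (Finset.sum_eq_zero_iff_of_nonneg hnonneg).mp hzero j (Finset.mem_erase.mpr ⟨hji, hj⟩)
  exact mul_self_eq_zero.mp this

/-- **A DM-positive virtual character of degree `1` is a linear character.**  `|χ(g)| ≤ 1` gives
`⟨χ, χ⟩ = |G|⁻¹ Σ |χ(g)|² ≤ 1`, while `⟨χ, χ⟩ = Σ_ψ ⟨χ, ψ⟩²` is a positive integer (`χ ≠ 0`); so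
`χ = ±ψ₀` for one irreducible `ψ₀`, and `χ(1) = 1 > 0` gives `χ = ψ₀` (of degree `1`).
[cite: Booker2006, §2 Definition 2.1 p. 389] [cite: SerreLinearRepresentations1977, §2.3 Thm. 3] -/
theorem IsDMPositive.isIrrChar_of_apply_one_eq_one {χ : G → ℂ} (hχ : χ ∈ virtChars G)
    (hpos : IsDMPositive χ) (h1 : χ 1 = 1) : IsIrrChar G χ := by
  classical
  have hcl : IsClassFun χ := isClassFun_of_mem_virtChars hχ
  have hnorm : ∀ g : G, ‖χ g‖ ≤ 1 := fun g => by
    have := hpos.norm_apply_le hχ (N := 1) (by rw [h1, Nat.cast_one]) g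
    simpa using this
  set F := (irrChars_finite_holds G).toFinset with hF
  -- integral Fourier coefficients
  have hint : ∀ ψ ∈ F, ∃ a : ℤ, classInner χ ψ = a := fun ψ hψ =>
    exists_int_classInner_of_mem_virtChars hχ ((irrChars_finite_holds G).mem_toFinset.mp hψ)
  choose! a ha using hint
  -- `⟨χ, χ⟩ = Σ a_ψ²`
  have hpar : classInner χ χ = ((∑ ψ ∈ F, a ψ * a ψ : ℤ) : ℂ) := by
    rw [classInner_self_eq_sum_sq hcl, Int.cast_sum]
    exact Finset.sum_congr rfl fun ψ hψ => by rw [ha ψ hψ, Int.cast_mul]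
  -- `⟨χ, χ⟩ = |G|⁻¹ Σ |χ(g)|² ≤ 1`
  have hreal : classInner χ χ = (((∑ g : G, ‖χ g‖ ^ 2) / Fintype.card G : ℝ) : ℂ) := by
    rw [classInner_apply]
    simp_rw [apply_inv_eq_conj_of_mem_virtChars hχ, Complex.mul_conj, Complex.normSq_eq_norm_sq]
    push_cast
    ring
  have hle1 : (∑ g : G, ‖χ g‖ ^ 2) / Fintype.card G ≤ (1 : ℝ) := by
    have hcard : (0 : ℝ) < Fintype.card G := by exact_mod_cast Fintype.card_pos
    rw [div_le_one hcard]
    calc ∑ g : G, ‖χ g‖ ^ 2 ≤ ∑ _g : G, (1 : ℝ) := Finset.sum_le_sum fun g _ => by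
            have h := hnorm g
            have h0 := norm_nonneg (χ g)
            nlinarith
      _ = Fintype.card G := by simp
  have hsum_le : (∑ ψ ∈ F, a ψ * a ψ : ℤ) ≤ 1 := by
    have h : (((∑ ψ ∈ F, a ψ * a ψ : ℤ) : ℝ) : ℂ) ≤ ((1 : ℝ) : ℂ) := by
      have e : (((∑ ψ ∈ F, a ψ * a ψ : ℤ) : ℝ) : ℂ) = classInner χ χ := by
        rw [hpar]; norm_cast
      rw [e, hreal]
      exact Complex.real_le_real.mpr hle1
    have h' := Complex.real_le_real.mp h
    exact_mod_cast h'
  -- `χ ≠ 0`, so some coefficient is non-zero and the sum of squares is `≥ 1`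
  have hexp := hcl.eq_sum_classInner_smul
  have hsum_ge : 1 ≤ ∑ ψ ∈ F, a ψ * a ψ := by
    by_contra hcon
    have hle0 : ∑ ψ ∈ F, a ψ * a ψ ≤ 0 := by omega
    have hall : ∀ ψ ∈ F, a ψ = 0 := by
      intro ψ hψ
      have hnn : ∀ φ ∈ F, 0 ≤ a φ * a φ := fun φ _ => mul_self_nonneg _
      have h0 : ∑ ψ ∈ F, a ψ * a ψ = 0 := le_antisymm hle0 (Finset.sum_nonneg hnn)
      exact mul_self_eq_zero.mp ((Finset.sum_eq_zero_iff_of_nonneg hnn).mp h0 ψ hψ)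
    have hχ0 : χ = 0 := by
      rw [hexp]
      exact Finset.sum_eq_zero fun ψ hψ => by rw [ha ψ hψ, hall ψ hψ, Int.cast_zero, zero_smul]
    have : χ 1 = 0 := by rw [hχ0]; rfl
    rw [h1] at this
    exact one_ne_zero this
  have hone : ∑ ψ ∈ F, a ψ * a ψ = 1 := le_antisymm hsum_le hsum_ge
  obtain ⟨ψ₀, hψ₀F, hsq, hothers⟩ := exists_sq_eq_one_of_sum_sq_eq_one F a hone
  have hψ₀ : IsIrrChar G ψ₀ := (irrChars_finite_holds G).mem_toFinset.mp hψ₀F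
  -- `χ = a_{ψ₀} ψ₀`
  have hχeq : χ = (a ψ₀ : ℂ) • ψ₀ := by
    rw [hexp, ← Finset.add_sum_erase F _ hψ₀F, ha ψ₀ hψ₀F]
    have : ∑ ψ ∈ F.erase ψ₀, classInner χ ψ • ψ = 0 :=
      Finset.sum_eq_zero fun ψ hψ => by
        obtain ⟨hne, hmem⟩ := Finset.mem_erase.mp hψ
        rw [ha ψ hmem, hothers ψ hmem hne, Int.cast_zero, zero_smul]
    rw [this, add_zero]
  -- the sign: `a_{ψ₀} ψ₀(1) = 1` with `ψ₀(1) > 0`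
  obtain ⟨d, hd, hd1⟩ := hψ₀.exists_apply_one
  have hdpos : 0 < d := pos_of_mem_charDegrees hd
  have hprod : (a ψ₀ : ℂ) * d = 1 := by
    have := congrFun hχeq 1
    rw [Pi.smul_apply, smul_eq_mul, hd1, h1] at this
    exact this.symm
  have hprod' : a ψ₀ * (d : ℤ) = 1 := by exact_mod_cast hprod
  have hd1 : (1 : ℤ) ≤ (d : ℤ) := by exact_mod_cast hdpos
  have ha1 : a ψ₀ = 1 := by
    have hle : a ψ₀ ≤ 1 := by nlinarith
    have hge : 1 ≤ a ψ₀ := by nlinarith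
    exact le_antisymm hle hge
  rw [hχeq, ha1, Int.cast_one, one_smul]
  exact hψ₀

/-! ### Splittings `Tr ρ = χ₁ + χ₂` -/

/-- In a splitting `Tr ρ = χ₁ + χ₂`, scalar products add: `⟨χ₁, σ⟩ + ⟨χ₂, σ⟩ = ⟨Tr ρ, σ⟩` — the
linear system (2–7) behind Booker's GAP check. [cite: Booker2006, §2 (2–7) p. 390] -/
theorem classInner_add_eq_of_split {ρ χ₁ χ₂ : G → ℂ} (hsum : ρ = χ₁ + χ₂) (σ : G → ℂ) :
    classInner χ₁ σ + classInner χ₂ σ = classInner ρ σ := by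
  rw [hsum, classInner_add_left]

/-- **The degree criterion.** If `Tr ρ = χ₁ + χ₂` with `χ₂` a DM-positive virtual character and
`χ₁(1) = Tr ρ(1)`, then `χ₂ = 0`. [cite: Booker2006, §2 Definition 2.1 p. 389] -/
theorem eq_zero_of_split_of_apply_one_eq {ρ χ₁ χ₂ : G → ℂ} (hχ₂ : χ₂ ∈ virtChars G)
    (h₂ : IsDMPositive χ₂) (hsum : ρ = χ₁ + χ₂) (h1 : χ₁ 1 = ρ 1) : χ₂ = 0 := by
  refine h₂.eq_zero_of_apply_one_eq_zero hχ₂ ?_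
  have := congrFun hsum 1
  rw [Pi.add_apply, h1] at this
  exact add_eq_left.mp this.symm

/-- The degree criterion, symmetric form: `χ₁(1) ∈ {0, Tr ρ(1)}` forces `χ₁ = 0 ∨ χ₂ = 0`.
[cite: Booker2006, §2 Definition 2.1 p. 389] -/
theorem eq_zero_or_eq_zero_of_split_of_apply_one {ρ χ₁ χ₂ : G → ℂ} (hχ₁ : χ₁ ∈ virtChars G)
    (hχ₂ : χ₂ ∈ virtChars G) (h₁ : IsDMPositive χ₁) (h₂ : IsDMPositive χ₂) (hsum : ρ = χ₁ + χ₂)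
    (h1 : χ₁ 1 = 0 ∨ χ₁ 1 = ρ 1) : χ₁ = 0 ∨ χ₂ = 0 := by
  rcases h1 with h1 | h1
  · exact Or.inl (h₁.eq_zero_of_apply_one_eq_zero hχ₁ h1)
  · exact Or.inr (eq_zero_of_split_of_apply_one_eq hχ₂ h₂ hsum h1)

/-- In a DM-positive splitting of an irreducible `ρ`, the scalar products with a monomial
character `Ind_H^G θ` are natural numbers `n₁ + n₂ = ⟨ρ, Ind θ⟩`.
[cite: Booker2006, §2 (2–7) p. 390] -/
theorem exists_nat_classInner_of_split {ρ χ₁ χ₂ : G → ℂ} (hρ : IsIrrChar G ρ)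
    (hχ₁ : χ₁ ∈ virtChars G) (hχ₂ : χ₂ ∈ virtChars G) (h₁ : IsDMPositive χ₁) (h₂ : IsDMPositive χ₂)
    (hsum : ρ = χ₁ + χ₂) (H : Subgroup G) (θ : H →* ℂˣ) :
    ∃ n₁ n₂ m : ℕ, classInner χ₁ (indClassFun H fun h => (θ h : ℂ)) = n₁ ∧
      classInner χ₂ (indClassFun H fun h => (θ h : ℂ)) = n₂ ∧
      classInner ρ (indClassFun H fun h => (θ h : ℂ)) = m ∧ n₁ + n₂ = m := by
  obtain ⟨n₁, hn₁⟩ := h₁.exists_nat_classInner_indClassFun hχ₁ H θ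
  obtain ⟨n₂, hn₂⟩ := h₂.exists_nat_classInner_indClassFun hχ₂ H θ
  obtain ⟨m, hm⟩ := hρ.isCharacter.classInner_natCast ((isCharacter_coe_monoidHom' θ).indClassFun H)
  refine ⟨n₁, n₂, m, hn₁, hn₂, hm, ?_⟩
  have h := classInner_add_eq_of_split hsum (indClassFun H fun h => (θ h : ℂ))
  rw [hn₁, hn₂, hm] at h
  exact_mod_cast h

/-- In a DM-positive splitting of an irreducible `ρ`, `χ₁` has no linear constituent `λ ≠ ρ`:
`⟨χ₁, λ⟩ = 0` for every `λ : G → ℂˣ` with `λ ≠ Tr ρ` (`0 ≤ ⟨χᵢ, λ⟩`, `λ = Ind_G^G λ` monomial, and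
`⟨χ₁, λ⟩ + ⟨χ₂, λ⟩ = ⟨ρ, λ⟩ = 0`). [cite: Booker2006, §2 (2–7) p. 390] -/
theorem classInner_coe_monoidHom_eq_zero_of_split {ρ χ₁ χ₂ : G → ℂ} (hρ : IsIrrChar G ρ)
    (hχ₁ : χ₁ ∈ virtChars G) (hχ₂ : χ₂ ∈ virtChars G) (h₁ : IsDMPositive χ₁) (h₂ : IsDMPositive χ₂)
    (hsum : ρ = χ₁ + χ₂) (θ : G →* ℂˣ) (hne : ρ ≠ fun g => (θ g : ℂ)) :
    classInner χ₁ (fun g => (θ g : ℂ)) = 0 := by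
  obtain ⟨n₁, n₂, m, hn₁, hn₂, hm, hnm⟩ :=
    exists_nat_classInner_of_split hρ hχ₁ hχ₂ h₁ h₂ hsum ⊤ (θ.comp (Subgroup.subtype ⊤))
  rw [indClassFun_top_coe_monoidHom] at hn₁ hn₂ hm
  have hm0 : m = 0 := by
    have h := hρ.classInner_eq (isIrrChar_coe_monoidHom_aux θ)
    rw [if_neg hne, hm] at h
    exact_mod_cast h
  have hn0 : n₁ = 0 := by omega
  rw [hn₁, hn0, Nat.cast_zero]

/-- The linear case of a splitting: if `Tr ρ = χ₁ + χ₂` (DM-positive virtual characters) and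
`χ₁(1) = 1`, then `χ₂ = 0`.  Indeed `χ₁ = λ` is a linear character, `λ = Ind_G^G λ` is monomial, so
`⟨ρ, λ⟩ = 1 + ⟨χ₂, λ⟩ ≥ 1`, forcing `ρ = λ = χ₁`. [cite: Booker2006, §2 Definition 2.1 p. 389] -/
theorem eq_zero_of_split_of_apply_one_eq_one {ρ χ₁ χ₂ : G → ℂ} (hρ : IsIrrChar G ρ)
    (hχ₁ : χ₁ ∈ virtChars G) (hχ₂ : χ₂ ∈ virtChars G) (h₁ : IsDMPositive χ₁) (h₂ : IsDMPositive χ₂)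
    (hsum : ρ = χ₁ + χ₂) (h1 : χ₁ 1 = 1) : χ₂ = 0 := by
  have hlin : IsIrrChar G χ₁ := h₁.isIrrChar_of_apply_one_eq_one hχ₁ h1
  obtain ⟨θ, hθ⟩ := hlin.exists_monoidHom_of_apply_one h1
  by_cases hρχ : ρ = χ₁
  · refine eq_zero_of_split_of_apply_one_eq hχ₂ h₂ hsum ?_
    rw [hρχ]
  · exfalso
    have h0 := classInner_coe_monoidHom_eq_zero_of_split hρ hχ₁ hχ₂ h₁ h₂ hsum θ (by rwa [hθ])
    rw [hθ, hlin.classInner_eq hlin, if_pos rfl] at h0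
    exact one_ne_zero h0

/-- **Irreducible characters of degree `≤ 3` do not split.**  In any finite group `G`: if
`Tr ρ = χ₁ + χ₂` with `ρ` irreducible of degree `≤ 3` and `χ₁, χ₂` DM-positive virtual characters
(`⟨χᵢ, σ⟩ ≥ 0` for all monomial `σ`), then `χ₁ = 0` or `χ₂ = 0`.  (Degrees `N₁ + N₂ = deg ρ ≤ 3`
with `Nᵢ ∈ ℕ`; `Nᵢ = 0` gives `χᵢ = 0`, otherwise some `Nᵢ = 1` and the linear case applies.)
[cite: Booker2006, §2 Definition 2.1 p. 389, Proposition 2.3 p. 390] -/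
theorem eq_zero_or_eq_zero_of_split_of_apply_one_le_three {ρ χ₁ χ₂ : G → ℂ} (hρ : IsIrrChar G ρ)
    (hχ₁ : χ₁ ∈ virtChars G) (hχ₂ : χ₂ ∈ virtChars G) (h₁ : IsDMPositive χ₁) (h₂ : IsDMPositive χ₂)
    (hsum : ρ = χ₁ + χ₂) {d : ℕ} (hd : ρ 1 = d) (hd3 : d ≤ 3) : χ₁ = 0 ∨ χ₂ = 0 := by
  obtain ⟨N₁, hN₁⟩ := h₁.exists_nat_apply_one_eq hχ₁
  obtain ⟨N₂, hN₂⟩ := h₂.exists_nat_apply_one_eq hχ₂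
  have hN : N₁ + N₂ = d := by
    have h := congrFun hsum 1
    rw [Pi.add_apply, hd, hN₁, hN₂] at h
    exact_mod_cast h.symm
  by_cases h10 : N₁ = 0
  · exact Or.inl (h₁.eq_zero_of_apply_one_eq_zero hχ₁ (by rw [hN₁, h10, Nat.cast_zero]))
  by_cases h20 : N₂ = 0
  · exact Or.inr (h₂.eq_zero_of_apply_one_eq_zero hχ₂ (by rw [hN₂, h20, Nat.cast_zero]))
  by_cases h11 : N₁ = 1
  · exact Or.inr (eq_zero_of_split_of_apply_one_eq_one hρ hχ₁ hχ₂ h₁ h₂ hsum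
      (by rw [hN₁, h11, Nat.cast_one]))
  by_cases h21 : N₂ = 1
  · exact Or.inl (eq_zero_of_split_of_apply_one_eq_one hρ hχ₂ hχ₁ h₂ h₁
      (hsum.trans (add_comm _ _)) (by rw [hN₂, h21, Nat.cast_one]))
  exfalso
  omega

/-- **A finite group whose character degrees are all `≤ 3` is almost monomial** (Booker's
Definition 2.1). [cite: Booker2006, §2 Definition 2.1 p. 389] -/
theorem isAlmostMonomial_of_charDegrees_le_three (h : ∀ d ∈ charDegrees G, d ≤ 3) :
    IsAlmostMonomial G := by
  intro ρ hρ χ₁ hχ₁ χ₂ hχ₂ h₁ h₂ hsum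
  have hρ' : IsIrrChar G ρ := hρ
  obtain ⟨d, hd, hd1⟩ := hρ'.exists_apply_one
  exact eq_zero_or_eq_zero_of_split_of_apply_one_le_three hρ' hχ₁ hχ₂ h₁ h₂ hsum hd1 (h d hd)

/-! ### `SL₂(𝔽₃)` -/

/-- The character degrees of `SL₂(𝔽₃)` are `≤ 3` (they are `1, 1, 1, 2, 2, 2, 3`: James–Liebeck
Exercise 27.2; tree `JamesLiebeck2001_exercise272_degrees`, `SL23.charDegrees_subset`).
[cite: JamesLiebeck2001, Exercise 27.2 (p. 319), solution pp. 440 ff.] -/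
theorem charDegrees_SL23_le_three : ∀ d ∈ charDegrees SL(2, ZMod 3), d ≤ 3 := by
  intro d hd
  have hmem := SL23.charDegrees_subset hd
  simp only [List.mem_cons, List.mem_nil_iff, or_false] at hmem
  rcases hmem with rfl | rfl | rfl | rfl
  · norm_num
  · norm_num
  · norm_num
  · -- no irreducible character of degree `4`
    exfalso
    obtain ⟨V, _, _, _, ρ, hρ, hV⟩ := hd
    have hχ : IsIrrChar SL(2, ZMod 3) ρ.character := ⟨V, _, _, inferInstance, ρ, hρ, rfl⟩
    have h1 : ρ.character 1 = ((4 : ℕ) : ℂ) := by rw [ρ.char_one, hV]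
    have hne : Nonempty {χ : SL(2, ZMod 3) → ℂ // IsIrrChar _ χ ∧ χ 1 = ((4 : ℕ) : ℂ)} :=
      ⟨⟨ρ.character, hχ, h1⟩⟩
    have hfin : Finite {χ : SL(2, ZMod 3) → ℂ // IsIrrChar _ χ ∧ χ 1 = ((4 : ℕ) : ℂ)} :=
      ((irrChars_finite_holds SL(2, ZMod 3)).subset (fun χ hχ => hχ.1)).to_subtype
    have hpos : 0 < Nat.card {χ : SL(2, ZMod 3) → ℂ // IsIrrChar _ χ ∧ χ 1 = ((4 : ℕ) : ℂ)} :=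
      Nat.card_pos
    have h0 := JamesLiebeck2001_exercise272_degrees.2.2.2
    omega

/-- **Booker 2006, Proposition 2.3, first group, PROVED: `SL₂(𝔽₃)` is almost monomial** — by
the structural theorem `isAlmostMonomial_of_charDegrees_le_three` instead of the source's GAP
computation. (`SL₂(𝔽₃)` is not an M-group: its `2`-dimensional irreducibles are not induced, as it
has no subgroup of index `2`.) [cite: Booker2006, §2 Proposition 2.3 p. 390] -/
theorem isAlmostMonomial_SL23 : IsAlmostMonomial SL(2, ZMod 3) :=
  isAlmostMonomial_of_charDegrees_le_three charDegrees_SL23_le_three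

end Booker2006

end Literature.NumberTheory.LFunctions

end
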